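import Mathlib
import Literature.MathematicalPhysics.QuantumFieldTheory.Balaban1983to89.B12Ineq45

/-!
# `Balaban1983to89.B12Sect4Statements` — T. Bałaban, *Renormalization group approach to lattice gauge field theories.
I. Generation of effective actions in a small field approximation and a coupling constant renormalization in four
dimensions*, Commun. Math. Phys. **109** (1987) 249–301 [Balaban1987RG1]: the §4 statements on the bilocal second sum
of (4.21), pp. 285–286 — (4.22), the p. 286 display preceding it, the two-case sentence and the "More generally"
remark — as named `Prop`s (X-read targets requested by the NE spine), with the proofs the tree already has wired to them

statement-level skeleton of published theorems with citation tags; proofs where landed; nothing here is a claim about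
the Yang–Mills mass gap

PDF held: `paper:balaban1987-cmp109-rg-i-small-field` (journal page = PDF page + 248); quotations read as images from
`run/shared/lean/pub/pub-balaban/b2b-balaban-ref1/pages/1987-cmp109-rg-I-small-field/1987-cmp109-rg-I-small-field-p037-x2.png`
(p. 285) and `…-p038-x2.png` (p. 286).

CITATION HEADER / WHAT IS REPRODUCED (unit `lit-balaban-r20`, fold owner of B12–B16; SKELETON row `B12.Eq4.21-4.22`,
PHASE2-TARGETS owner r09/r20; requested in `HOME/INBOX.md` 2026-08-20T22:25:14Z / 22:27:09Z by the NE9 owner and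
acknowledged 22:27Z by the lead — NEED-1 «the bilocal second-species summand bound as ONE `…Printed` Prop covering BOTH
cases — different blocks (dischargeable from PROVED `B12Ineq45.term_bound_pair`) and same block ([15] Sect. G
tree-graph decay = cell GAPS G-B11-G2a, not typed)», suggested name `KernelBound422Printed`):

p. 285 [PDF 37], verbatim: *"Let us consider the third term in the above sum. We apply the same method which was used
in [7], see especially (3.25)–(3.32) [7]. We write
  ⟨𝐄⁽⁴⁾, δB, ⊗³B⟩ = Σ_{(μ,x),…,(μ₃,x₃)} ⟨𝐄⁽⁴⁾_{μ,μ₁,μ₂,μ₃}(x, x₁, x₂, x₃), δB_μ(x), B_{μ₁}(x₁), B_{μ₂}(x₂), B_{μ₃}(x)⟩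
   + Σ_{(μ,x),…,(μ₃,x₃)} ⟨𝐄⁽⁴⁾_{μ,μ₁,μ₂,μ₃}(x, x₁, x₂, x₃), δB_μ(x), B_{μ₁}(x₁), B_{μ₂}(x₂), (∂B_{μ₃})(Γ_{x,x₃})⟩.  (4.21)"*

p. 286 [PDF 38], verbatim: *"Because of the bound (4.17) the second term on the right-hand side above should have a
bound of the form (3.35). To prove it we use the identities (4.3) again. There is a problem now, connected with the
facts that the last factor (∂B_{μ₃})(Γ_{x,x₃}) is a function of two points instead of one, and it has the bound
|(∂B_{μ₃})(Γ_{x,x₃})| < α₁(L^jη)²|Γ_{x,x₃}|. The length |Γ_{x,x₃}| = |x₃ − x| is in ξ-scale, so it can be very big (of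
the order O(M(L^jη)⁻¹) for points x, x₃ in □̃⁴, but far apart. We have to use the exponential decay properties to get
a proper bound. Consider two possible cases. In the first the points x, x₃ are connected with the same set N(p) in
(4.3). Then the exponential factor, with a length of a shortest tree graph in the exponent, yields the factor
exp(−δ₀|x₃ − x|), and the product of it with |x₃ − x| is bounded by δ₀⁻¹. The second case is more complicated, the
points x, x₃ are connected with different sets in a partition, and we apply the identities (4.3) with localizations at
the points x, x₃ fixed, i.e. with the summations over x, x₃ left undone. A term corresponding to such a partition can
be estimated by
  Σ_{x,x₃} (8B₃ (1/α₂))⁴ E₀ exp(−κd_j(X) − δ₀ dist^{(ξ)}(X, x) − δ₀ dist^{(ξ)}(X, x₃)) |B|² |δB(x)| |(∂B)(Γ_{x,x₃})|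
   < Σ_{x,x₃} (8B₃ (α₁/α₂))⁴ E₀ exp(−⅓κd_j(X) − δ₁|x − x₀| − δ₁|x₃ − x|) |x₃ − x| (L^jη)⁵,
where x₀ is a fixed point in X. The exponential decay factors with δ₁ are determined by the three factors on the
left-hand side, therefore the decay rate is rather poor, δ₁ = O(M⁻¹), because of the factor with κd_j(X). Summing over
x, x₃ we get finally the following estimate
  |(the second sum in (4.21))| ≦ (32B₃ (α₁/α₂) c₀(δ₁)c₁(δ₁))⁴ exp(−⅓κd_j(X)) (L^jη)⁵,  (4.22)
hence this sum in (4.21) represents an irrelevant term. More generally, let us notice that by a similar argument we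
can bound the derivative 𝐄⁽ⁿ⁾(X, x₁, …, x_n) by a constant times the exponential  exp(−O(1)κd_j(X∪{x₁, …, x_n})),
where d_j(X∪{x₁, …, x_n}) is a length of a shortest tree graph connecting cubes □ building the domain X, and points
x₁, …, x_n. This bound is enough to prove bounds of the type (4.22), although with a worse constant."*

WHAT THIS MODULE DOES (imports `Mathlib` and `…Balaban1983to89.B12Ineq45` — the kernel-checked (4.3)–(4.5) module:
`dirIter`, `term_bound_pair`, `card_blocks_le`, `card_finpartitions_le`; modifies nothing; 0 sorry; every display is
a `Prop` over printed numbers / abstract carriers, NOTHING of the series is asserted):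

1. `Data422`, `KernelBound422Printed` — **(4.22)** typed verbatim over the printed numbers: THE decl of record for
   the bilocal second sum of (4.21), both cases of p. 286 summed (the «ONE Prop covering both cases»).
2. `PointData286`, `lhsSummand`, `rhsSummand`, `Display286Printed` — the p. 286 display (both members, the printed
   strict `<`) over an abstract finite carrier `P` of the points x, x₃ (unit-lattice points of □̃⁴) with the printed
   point functions dist^{(ξ)}(X,·), |δB(·)|, |(∂B)(Γ_{·,·})|, |· − x₀|, |x₃ − x|; `TermEstimate286Printed` — *"A term
   corresponding to such a partition can be estimated by [the left member]"* (the DIFFERENT-BLOCKS case);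
   `SameBlockFactor286Printed` — the first case: the tree-graph exponential of a same-block term supplies
   exp(−δ₀|x₃ − x|) (the by-reference input of [15] Sect. G for SEVERAL localized arguments in ONE block — cell GAPS
   G-B11-G2a, `B12Ineq45` «WHAT IS NOT HERE»; hypothesis shape, not proved); `TreeDecayRemark286Printed` — the «More
   generally» remark with its unprinted constant and O(1) rate as explicit parameters.
3. PROVED (kernel bookkeeping, no new facts): `pow_blocks_le_pow_four` ((2rB₃/α₂)^r ≤ (8B₃/α₂)⁴ for r ≤ 4 blocks once
   8B₃ ≥ α₂); `differentBlocks_term_le` — ONE TERM OF THE SECOND CASE from `B12Ineq45.term_bound_pair`: the four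
   arguments δB(x), B, B, (∂B)(Γ_{x,x₃}) with sizes |δB(x)|, |B|, |B|, |(∂B)(Γ_{x,x₃})|, the two localized ones in
   DIFFERENT blocks with the p. 282 weights exp(−δ₀dist^{(ξ)}(X,x)), exp(−δ₀dist^{(ξ)}(X,x₃)), `f = 𝐀 ↦ 𝐄^{(j)}(X,
   exp iξ𝐀)` holomorphic on the ball (4.4) with sup `E₀e^{−κd_j(X)}` ((1.18)) ⇒ the term is ≤ `lhsSummand x x₃` — the
   left member of the p. 286 display IS (4.3) + (4.4) + (1.18) + p. 282, kernel-checked;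
   `termEstimate286_of_pointwise` (pointwise ⇒ the printed summed sentence); `sameBlock_product_le` (*"the product
   of it with |x₃ − x| is bounded by δ₀⁻¹"*: e^{−δ₀t}·t ≤ δ₀⁻¹); `display286_rhs_sum_le` (the right member summed
   with lattice-sum constants c₀(δ₁) ≥ Σ_x e^{−δ₁|x−x₀|}, c₁(δ₁) ≥ Σ_{x₃} e^{−δ₁|x₃−x|}|x₃−x| — their only printed
   description is the symbol "c₀(δ₁)c₁(δ₁)" in (4.22); typed as hypotheses); `differentBlocks_summed_le` (the second
   case end to end); `secondSum_le_of_terms` / `kernelBound422_of_terms` — *"Summing over x, x₃ we get finally"*: a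
   family of at most 4⁴ partition terms (Bell(4) ≤ 4⁴, `card_finpartitions_le`), each bounded after the x, x₃
   summation by (8B₃α₁α₂⁻¹)⁴E₀c₀c₁e^{−⅓κd_j(X)}(L^jη)⁵, sums to 4⁴·(8B₃α₁α₂⁻¹)⁴(…) = (32B₃α₁α₂⁻¹)⁴E₀c₀c₁(…) (32 = 2·4²,
   the (4.5) pattern (2n²B₃α₂⁻¹)ⁿ at n = 4), which is the printed right member of (4.22) when E₀ ≤ 1 ≤ c₀c₁ —
   sufficient bookkeeping stated as hypotheses: the print does not display how E₀ and the partition count enter its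
   constant.

WHAT IS *NOT* HERE: the identity (4.21) itself and the first sum of (4.21) ((4.23) ff.; rows `B12.Eq4.22-4.23`,
module `B12Marginal444`); the bound (4.17) |(∂B)(Γ_{x,x₃})| < α₁(L^jη)²|Γ_{x,x₃}| and the sizes of B, δB that turn the
left member of the display into its right member (the passage names "the three factors on the left-hand side" and
δ₁ = O(M⁻¹) without a displayed derivation — the right member is TYPED, not derived); the same-block tree-graph decay
([15] Sect. G with several initial points; GAPS G-B11-G2a); the words "represents an irrelevant term" (the bookkeeping
of (0.28)/(3.35)). Value = typed displays of record + kernel-checked derivation of the located different-blocks step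
modulo named printed leaves, NOT summit progress.
-/

noncomputable section

open Set Metric Finset
open scoped BigOperators

namespace Literature.MathematicalPhysics.QuantumFieldTheory.Balaban1983to89.B12Sect4Statements

open Literature.MathematicalPhysics.QuantumFieldTheory.Balaban1983to89
open B12Ineq45

/-! ## (4.22) p. 286 — the decl of record -/

/-- The numbers printed in (4.22) (p. 286 [38]): the modulus `lhs2` of *"the second sum in (4.21)"* (the bilocal sum
`Σ_{(μ,x),…,(μ₃,x₃)} ⟨𝐄⁽⁴⁾_{μ,μ₁,μ₂,μ₃}(x,x₁,x₂,x₃), δB_μ(x), B_{μ₁}(x₁), B_{μ₂}(x₂), (∂B_{μ₃})(Γ_{x,x₃})⟩` of p. 285),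
the constants `B₃` (p. 282, from [15] Sect. G), `α₁` ((3.32)/(4.17)), `α₂` ((4.4)), the lattice-sum constants
`c₀ = c₀(δ₁)`, `c₁ = c₁(δ₁)` (named only through (4.22); *"δ₁ = O(M⁻¹)"*), `κ` and `djX = d_j(X)` ((1.18)), and
`Ljη = L^jη`. [cite: Balaban1987RG1, (4.21)–(4.22) pp.285–286] -/
structure Data422 where
  lhs2 : ℝ
  B₃ : ℝ
  α₁ : ℝ
  α₂ : ℝ
  c₀ : ℝ
  c₁ : ℝ
  κ : ℝ
  djX : ℝ
  Ljη : ℝ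

/-- **(4.22)** (p. 286 [38], verbatim): *"Summing over x, x₃ we get finally the following estimate
|(the second sum in (4.21))| ≦ (32B₃ (α₁/α₂) c₀(δ₁)c₁(δ₁))⁴ exp(−⅓κd_j(X)) (L^jη)⁵,  (4.22)
hence this sum in (4.21) represents an irrelevant term."* — the decl of record for the bilocal second sum of (4.21),
BOTH cases of p. 286 (x, x₃ in the same block / in different blocks of the partition) summed; typed display-shape over
`Data422`, nothing of it is asserted (derivation modulo named leaves: `kernelBound422_of_terms`).
[cite: Balaban1987RG1, (4.22) p.286] -/
def KernelBound422Printed (D : Data422) : Prop :=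
  D.lhs2 ≤ (32 * D.B₃ * (D.α₁ / D.α₂) * D.c₀ * D.c₁) ^ 4 * Real.exp (-(1 / 3 * D.κ * D.djX)) * D.Ljη ^ 5

/-! ## The p. 286 display and the two-case sentence -/

/-- The data of the p. 286 display [38]: the printed constants `B₃, α₁, α₂, E₀, κ, d_j(X), δ₀, δ₁, L^jη`, the sup norm
`normB = |B|`, and — over an abstract carrier `P` of the points `x, x₃` (points of the unit lattice `T₁^{(j)}` in □̃⁴,
p. 285) — `x₀` (*"where x₀ is a fixed point in X"*), `distX x = dist^{(ξ)}(X, x)`, `δB x = |δB(x)|`,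
`dBΓ x x₃ = |(∂B)(Γ_{x,x₃})|` (*"a function of two points instead of one"*), `len x x₃ = |Γ_{x,x₃}| = |x₃ − x|`,
`dist0 x = |x − x₀|`. [cite: Balaban1987RG1, p.286] -/
structure PointData286 (P : Type*) where
  B₃ : ℝ
  α₁ : ℝ
  α₂ : ℝ
  E₀ : ℝ
  κ : ℝ
  djX : ℝ
  δ₀ : ℝ
  δ₁ : ℝ
  Ljη : ℝ
  normB : ℝ
  x₀ : P
  distX : P → ℝ
  δB : P → ℝ
  dBΓ : P → P → ℝ
  len : P → P → ℝ
  dist0 : P → ℝ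

namespace PointData286

variable {P : Type*} (D : PointData286 P)

/-- The `(x, x₃)` summand of the LEFT member of the p. 286 display:
`(8B₃ (1/α₂))⁴ E₀ exp(−κd_j(X) − δ₀dist^{(ξ)}(X, x) − δ₀dist^{(ξ)}(X, x₃)) |B|² |δB(x)| |(∂B)(Γ_{x,x₃})|`.
[cite: Balaban1987RG1, p.286] -/
def lhsSummand (x x₃ : P) : ℝ :=
  (8 * D.B₃ * (1 / D.α₂)) ^ 4 * D.E₀ *
    Real.exp (-(D.κ * D.djX) - D.δ₀ * D.distX x - D.δ₀ * D.distX x₃) *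
    D.normB ^ 2 * D.δB x * D.dBΓ x x₃

/-- The `(x, x₃)` summand of the RIGHT member of the p. 286 display:
`(8B₃ (α₁/α₂))⁴ E₀ exp(−⅓κd_j(X) − δ₁|x − x₀| − δ₁|x₃ − x|) |x₃ − x| (L^jη)⁵`. [cite: Balaban1987RG1, p.286] -/
def rhsSummand (x x₃ : P) : ℝ :=
  (8 * D.B₃ * (D.α₁ / D.α₂)) ^ 4 * D.E₀ *
    Real.exp (-(1 / 3 * D.κ * D.djX) - D.δ₁ * D.dist0 x - D.δ₁ * D.len x x₃) *
    D.len x x₃ * D.Ljη ^ 5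

/-- The left summand with its exponential split into the three printed factors (sup (1.18) · Cauchy radii · the two
localisation weights · the four sizes) — the printed left summand, refactored. [cite: Balaban1987RG1, p.286] -/
theorem lhsSummand_eq (x x₃ : P) :
    D.lhsSummand x x₃ = D.E₀ * Real.exp (-(D.κ * D.djX)) * (8 * D.B₃ / D.α₂) ^ 4 *
      (Real.exp (-(D.δ₀ * D.distX x)) * Real.exp (-(D.δ₀ * D.distX x₃))) *
      (D.δB x * D.normB * D.normB * D.dBΓ x x₃) := by
  unfold lhsSummand
  rw [show -(D.κ * D.djX) - D.δ₀ * D.distX x - D.δ₀ * D.distX x₃ =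
      -(D.κ * D.djX) + -(D.δ₀ * D.distX x) + -(D.δ₀ * D.distX x₃) by ring, Real.exp_add, Real.exp_add]
  ring

/-- The printed right summand factored as (x, x₃)-independent constant × e^{−δ₁|x−x₀|} × (e^{−δ₁|x₃−x|}|x₃ − x|).
[cite: Balaban1987RG1, p.286] -/
theorem rhsSummand_eq (x x₃ : P) :
    D.rhsSummand x x₃ = (8 * D.B₃ * (D.α₁ / D.α₂)) ^ 4 * D.E₀ * Real.exp (-(1 / 3 * D.κ * D.djX)) * D.Ljη ^ 5 *
      (Real.exp (-(D.δ₁ * D.dist0 x)) * (Real.exp (-(D.δ₁ * D.len x x₃)) * D.len x x₃)) := by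
  unfold rhsSummand
  rw [show -(1 / 3 * D.κ * D.djX) - D.δ₁ * D.dist0 x - D.δ₁ * D.len x x₃ =
      -(1 / 3 * D.κ * D.djX) + -(D.δ₁ * D.dist0 x) + -(D.δ₁ * D.len x x₃) by ring, Real.exp_add, Real.exp_add]
  ring

end PointData286

/-- **The p. 286 display** [38] (verbatim, both members, the printed strict sign): *"Σ_{x,x₃} (8B₃ (1/α₂))⁴ E₀
exp(−κd_j(X) − δ₀dist^{(ξ)}(X, x) − δ₀dist^{(ξ)}(X, x₃)) |B|² |δB(x)| |(∂B)(Γ_{x,x₃})| < Σ_{x,x₃} (8B₃ (α₁/α₂))⁴ E₀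
exp(−⅓κd_j(X) − δ₁|x − x₀| − δ₁|x₃ − x|) |x₃ − x| (L^jη)⁵, where x₀ is a fixed point in X."* — display-shape,
nothing asserted (its derivation — (4.17), the sizes of B and δB, and the geometry behind *"determined by the three
factors on the left-hand side … δ₁ = O(M⁻¹)"* — is not displayed in print). [cite: Balaban1987RG1, p.286] -/
def Display286Printed {P : Type*} [Fintype P] (D : PointData286 P) : Prop :=
  ∑ x, ∑ x₃, D.lhsSummand x x₃ < ∑ x, ∑ x₃, D.rhsSummand x x₃

/-- *"The second case is more complicated, the points x, x₃ are connected with different sets in a partition, and we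
apply the identities (4.3) with localizations at the points x, x₃ fixed, i.e. with the summations over x, x₃ left
undone. A term corresponding to such a partition can be estimated by [the left member of the display]"* (p. 286):
for the term of (4.3) belonging to a partition with x, x₃ in DIFFERENT blocks, written as the sum of its
(x, x₃)-localized pieces `termQ x x₃`: `‖Σ_{x,x₃} termQ x x₃‖ ≤ Σ_{x,x₃} lhsSummand x x₃`.  Display-shape; its
derivation from `B12Ineq45` is `differentBlocks_term_le` + `termEstimate286_of_pointwise`. [cite: Balaban1987RG1, p.286] -/
def TermEstimate286Printed {P : Type*} [Fintype P] {F : Type*} [NormedAddCommGroup F] (D : PointData286 P)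
    (termQ : P → P → F) : Prop :=
  ‖∑ x, ∑ x₃, termQ x x₃‖ ≤ ∑ x, ∑ x₃, D.lhsSummand x x₃

/-- *"In the first [case] the points x, x₃ are connected with the same set N(p) in (4.3). Then the exponential factor,
with a length of a shortest tree graph in the exponent, yields the factor exp(−δ₀|x₃ − x|)"* (p. 286): the
exponential (tree-graph) factor `expFactor x x₃` of a same-block term is at most `exp(−δ₀|x₃ − x|)` (`len x x₃ =
|x₃ − x|`).  This is the by-reference input of [15] Sect. G for several localized arguments in ONE block (p. 282:
*"Each expression corresponds to a tree graph with n(p) initial points and one final point, and it has an exponential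
decay in a length of this graph"*) — not typed as proved anywhere in the tree (cell GAPS G-B11-G2a); hypothesis shape
only, nothing asserted. [cite: Balaban1987RG1, p.286] -/
def SameBlockFactor286Printed {P : Type*} (δ₀ : ℝ) (len expFactor : P → P → ℝ) : Prop :=
  ∀ x x₃, expFactor x x₃ ≤ Real.exp (-(δ₀ * len x x₃))

/-- *"More generally, let us notice that by a similar argument we can bound the derivative 𝐄⁽ⁿ⁾(X, x₁, …, x_n) by a
constant times the exponential exp(−O(1)κd_j(X∪{x₁, …, x_n})), where d_j(X∪{x₁, …, x_n}) is a length of a shortest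
tree graph connecting cubes □ building the domain X, and points x₁, …, x_n. This bound is enough to prove bounds of
the type (4.22), although with a worse constant."* (p. 286) — over abstract carriers: the kernel `En xs` =
𝐄⁽ⁿ⁾(X, x₁, …, x_n) ((4.19): the n-th B-derivative of 𝐄^{(j)}(X, U_j(□₀, ·)) at 1, a ⊗ⁿ𝔤-valued function of n
points), the tree length `djXpts xs = d_j(X∪{x₁, …, x_n})`, and the unprinted "constant" `c` and "O(1)" rate `a` as
explicit parameters.  Display-shape, nothing asserted. [cite: Balaban1987RG1, p.286] -/
def TreeDecayRemark286Printed {P : Type*} {F : Type*} [Norm F] {n : ℕ} (En : (Fin n → P) → F)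
    (djXpts : (Fin n → P) → ℝ) (κ c a : ℝ) : Prop :=
  ∀ xs : Fin n → P, ‖En xs‖ ≤ c * Real.exp (-(a * κ * djXpts xs))

/-! ## Kernel bookkeeping (PROVED): the different-blocks term from `B12Ineq45.term_bound_pair`, the same-block
arithmetic, and the summation behind the constant of (4.22) -/

/-- `(2rB₃/α₂)^r ≤ (8B₃/α₂)⁴` for a partition of the FOUR arguments of (4.21) into `r ≤ 4` blocks, once `8B₃ ≥ α₂ > 0`
(a harmless normalisation of the constant of [15] Sect. G, as `2B₃ ≥ α₂` is for (4.5)): the display's `(8B₃ (1/α₂))⁴`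
is the (4.5) radii factor `(2nB₃/α₂)ⁿ` at n = 4. [cite: Balaban1987RG1, p.286] -/
theorem pow_blocks_le_pow_four {r : ℕ} (hr : r ≤ 4) {B₃ α₂ : ℝ} (hα : 0 < α₂) (hB : α₂ ≤ 8 * B₃) :
    (2 * (r : ℝ) * B₃ / α₂) ^ r ≤ (8 * B₃ / α₂) ^ 4 := by
  have hu : 1 ≤ 8 * B₃ / α₂ := by rw [le_div_iff₀ hα]; linarith
  have hB₃ : 0 ≤ B₃ := by linarith
  have hr' : (r : ℝ) ≤ 4 := by exact_mod_cast hr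
  have h1 : 2 * (r : ℝ) * B₃ / α₂ ≤ 8 * B₃ / α₂ := by
    apply div_le_div_of_nonneg_right _ hα.le
    nlinarith
  calc (2 * (r : ℝ) * B₃ / α₂) ^ r ≤ (8 * B₃ / α₂) ^ r := pow_le_pow_left₀ (by positivity) h1 r
    _ ≤ (8 * B₃ / α₂) ^ 4 := pow_le_pow_right₀ hu hr

/-- **One term of the second case of p. 286, from `B12Ineq45.term_bound_pair`.**  Hypotheses, all by name, at fixed
points `x, x₃`: `f` = `𝐀 ↦ 𝐄^{(j)}(X, exp iξ𝐀)` holomorphic on an open `U` containing the ball `‖𝐀‖ < α₂` of the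
(4.4)-norm with `‖f‖ ≤ E₀e^{−κd_j(X)}` there ((1.18)); the four arguments `δB_μ(x)`, `B_{μ₁}`, `B_{μ₂}`,
`(∂B_{μ₃})(Γ_{x,x₃})` of the second sum of (4.21) with sizes `|δB(x)|, |B|, |B|, |(∂B)(Γ_{x,x₃})|`, partitioned into
the blocks `N(p)` of (4.3); the `r` directions `v_p` with the p. 282 bounds `‖v_p‖ ≤ w_p · B₃ Π_{i∈N(p)} size_i`,
weights `w_p ∈ [0, 1]`, the block `p₀` of the x-localized argument weighted by `exp(−δ₀dist^{(ξ)}(X, x))` and the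
DIFFERENT block `p₁` of the x₃-localized one by `exp(−δ₀dist^{(ξ)}(X, x₃))`; `8B₃ ≥ α₂`.  Conclusion: the term
`∂ʳ/∂τ₁…∂τ_r f(Σ_p τ_p v_p)|_{τ=0}` is at most the `(x, x₃)` summand of the left member of the p. 286 display.
[cite: Balaban1987RG1, p.286; (4.3)–(4.5) pp.281–282] -/
theorem differentBlocks_term_le {P : Type*} (D : PointData286 P) (x x₃ : P)
    {E : Type*} [NormedAddCommGroup E] [NormedSpace ℂ E] {F : Type*} [NormedAddCommGroup F] [NormedSpace ℂ F]
    [CompleteSpace F]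
    {U : Set E} (hU : IsOpen U) (hα : 0 < D.α₂) (hB : D.α₂ ≤ 8 * D.B₃) (hball : ball (0 : E) D.α₂ ⊆ U)
    {f : E → F} (hf : DifferentiableOn ℂ f U)
    (hS : ∀ y ∈ ball (0 : E) D.α₂, ‖f y‖ ≤ D.E₀ * Real.exp (-(D.κ * D.djX)))
    (hnormB : 0 ≤ D.normB) (hδB : 0 ≤ D.δB x) (hdBΓ : 0 ≤ D.dBΓ x x₃)
    {r : ℕ} (N : Fin r → Finset (Fin 4)) (hdisj : ∀ p q, p ≠ q → Disjoint (N p) (N q))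
    (hcov : Finset.univ.biUnion N = Finset.univ) (hne : ∀ p, (N p).Nonempty)
    (w : Fin r → ℝ) (hw0 : ∀ p, 0 ≤ w p) (hw1 : ∀ p, w p ≤ 1) {p₀ p₁ : Fin r} (hp : p₀ ≠ p₁)
    (hwp₀ : w p₀ ≤ Real.exp (-(D.δ₀ * D.distX x))) (hwp₁ : w p₁ ≤ Real.exp (-(D.δ₀ * D.distX x₃)))
    (v : Fin r → E)
    (hv : ∀ p, ‖v p‖ ≤ w p * (D.B₃ * ∏ i ∈ N p, ![D.δB x, D.normB, D.normB, D.dBΓ x x₃] i)) :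
    ‖dirIter r v f 0‖ ≤ D.lhsSummand x x₃ := by
  have hB₃ : 0 ≤ D.B₃ := by linarith
  have hb0 : ∀ i, 0 ≤ (![D.δB x, D.normB, D.normB, D.dBΓ x x₃] : Fin 4 → ℝ) i := by
    intro i
    fin_cases i
    · simpa using hδB
    · simpa using hnormB
    · simpa using hnormB
    · simpa using hdBΓ
  have h1 := term_bound_pair hU hα hball hf hS hB₃ N hdisj hcov
    (![D.δB x, D.normB, D.normB, D.dBΓ x x₃]) hb0 w hw0 hw1 v hv hp
  have hr : r ≤ 4 := by simpa using card_blocks_le N hdisj hcov hne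
  have hpow := pow_blocks_le_pow_four hr hα hB
  have hS0 : 0 ≤ D.E₀ * Real.exp (-(D.κ * D.djX)) := (norm_nonneg _).trans (hS 0 (mem_ball_self hα))
  have hww : w p₀ * w p₁ ≤ Real.exp (-(D.δ₀ * D.distX x)) * Real.exp (-(D.δ₀ * D.distX x₃)) :=
    mul_le_mul hwp₀ hwp₁ (hw0 p₁) (Real.exp_pos _).le
  have hP0 : 0 ≤ ∏ i, (![D.δB x, D.normB, D.normB, D.dBΓ x x₃] : Fin 4 → ℝ) i :=
    Finset.prod_nonneg fun i _ => hb0 i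
  have hprod : ∏ i, (![D.δB x, D.normB, D.normB, D.dBΓ x x₃] : Fin 4 → ℝ) i =
      D.δB x * D.normB * D.normB * D.dBΓ x x₃ := by
    rw [Fin.prod_univ_four]
    simp
  have step : D.E₀ * Real.exp (-(D.κ * D.djX)) * (2 * (r : ℝ) * D.B₃ / D.α₂) ^ r * (w p₀ * w p₁) *
        ∏ i, (![D.δB x, D.normB, D.normB, D.dBΓ x x₃] : Fin 4 → ℝ) i ≤
      D.E₀ * Real.exp (-(D.κ * D.djX)) * (8 * D.B₃ / D.α₂) ^ 4 *
        (Real.exp (-(D.δ₀ * D.distX x)) * Real.exp (-(D.δ₀ * D.distX x₃))) *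
        ∏ i, (![D.δB x, D.normB, D.normB, D.dBΓ x x₃] : Fin 4 → ℝ) i := by
    apply mul_le_mul_of_nonneg_right _ hP0
    apply mul_le_mul _ hww (mul_nonneg (hw0 _) (hw0 _))
    · exact mul_nonneg hS0 (pow_nonneg (by positivity) _)
    · exact mul_le_mul_of_nonneg_left hpow hS0
  calc ‖dirIter r v f 0‖ ≤ _ := h1
    _ ≤ _ := step
    _ = D.lhsSummand x x₃ := by rw [hprod, D.lhsSummand_eq]

/-- Pointwise term bounds at every `(x, x₃)` give the printed summed sentence *"A term corresponding to such a
partition can be estimated by Σ_{x,x₃} (…)"*. [cite: Balaban1987RG1, p.286] -/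
theorem termEstimate286_of_pointwise {P : Type*} [Fintype P] {F : Type*} [NormedAddCommGroup F]
    (D : PointData286 P) (termQ : P → P → F) (h : ∀ x x₃, ‖termQ x x₃‖ ≤ D.lhsSummand x x₃) :
    TermEstimate286Printed D termQ := by
  unfold TermEstimate286Printed
  calc ‖∑ x, ∑ x₃, termQ x x₃‖ ≤ ∑ x, ‖∑ x₃, termQ x x₃‖ := norm_sum_le _ _
    _ ≤ ∑ x, ∑ x₃, ‖termQ x x₃‖ := Finset.sum_le_sum fun x _ => norm_sum_le _ _
    _ ≤ ∑ x, ∑ x₃, D.lhsSummand x x₃ :=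
        Finset.sum_le_sum fun x _ => Finset.sum_le_sum fun x₃ _ => h x x₃

/-- *"and the product of it with |x₃ − x| is bounded by δ₀⁻¹"* (p. 286, the first case): `e^{−δ₀t}·t ≤ δ₀⁻¹` for
`δ₀ > 0` and every real `t` (from `1 + s ≤ eˢ`). [cite: Balaban1987RG1, p.286] -/
theorem sameBlock_product_le {δ₀ : ℝ} (hδ : 0 < δ₀) (t : ℝ) : Real.exp (-(δ₀ * t)) * t ≤ δ₀⁻¹ := by
  have h1 : δ₀ * t ≤ Real.exp (δ₀ * t) := by
    have := Real.add_one_le_exp (δ₀ * t)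
    linarith
  have h2 : Real.exp (-(δ₀ * t)) * (δ₀ * t) ≤ 1 := by
    rw [Real.exp_neg, inv_mul_le_iff₀ (Real.exp_pos _)]
    simpa using h1
  have h3 : Real.exp (-(δ₀ * t)) * t = Real.exp (-(δ₀ * t)) * (δ₀ * t) * δ₀⁻¹ := by
    field_simp
  rw [h3]
  calc Real.exp (-(δ₀ * t)) * (δ₀ * t) * δ₀⁻¹ ≤ 1 * δ₀⁻¹ :=
      mul_le_mul_of_nonneg_right h2 (inv_nonneg.mpr hδ.le)
    _ = δ₀⁻¹ := one_mul _

/-- **The right member of the p. 286 display summed over x, x₃** with the lattice-sum constants of (4.22):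
`c₀ = c₀(δ₁) ≥ Σ_x e^{−δ₁|x − x₀|}` and `c₁ = c₁(δ₁) ≥ Σ_{x₃} e^{−δ₁|x₃ − x|}|x₃ − x|` (every x) give
`Σ_{x,x₃} rhsSummand ≤ (8B₃α₁α₂⁻¹)⁴ E₀ c₀ c₁ e^{−⅓κd_j(X)} (L^jη)⁵`. [cite: Balaban1987RG1, p.286, (4.22)] -/
theorem display286_rhs_sum_le {P : Type*} [Fintype P] (D : PointData286 P) {c₀ c₁ : ℝ}
    (hE₀ : 0 ≤ D.E₀) (hL : 0 ≤ D.Ljη) (hc₁ : 0 ≤ c₁)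
    (hsum0 : ∑ x, Real.exp (-(D.δ₁ * D.dist0 x)) ≤ c₀)
    (hsum1 : ∀ x, ∑ x₃, Real.exp (-(D.δ₁ * D.len x x₃)) * D.len x x₃ ≤ c₁) :
    ∑ x, ∑ x₃, D.rhsSummand x x₃ ≤
      (8 * D.B₃ * (D.α₁ / D.α₂)) ^ 4 * D.E₀ * c₀ * c₁ * Real.exp (-(1 / 3 * D.κ * D.djX)) * D.Ljη ^ 5 := by
  set A : ℝ := (8 * D.B₃ * (D.α₁ / D.α₂)) ^ 4 * D.E₀ * Real.exp (-(1 / 3 * D.κ * D.djX)) * D.Ljη ^ 5 with hAdef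
  have h8 : 0 ≤ (8 * D.B₃ * (D.α₁ / D.α₂)) ^ 4 := Even.pow_nonneg ⟨2, by norm_num⟩ _
  have hA : 0 ≤ A := mul_nonneg (mul_nonneg (mul_nonneg h8 hE₀) (Real.exp_pos _).le) (pow_nonneg hL _)
  calc ∑ x, ∑ x₃, D.rhsSummand x x₃
      = ∑ x, A * (Real.exp (-(D.δ₁ * D.dist0 x)) *
          ∑ x₃, Real.exp (-(D.δ₁ * D.len x x₃)) * D.len x x₃) := by
        refine Finset.sum_congr rfl fun x _ => ?_
        rw [Finset.mul_sum, Finset.mul_sum]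
        exact Finset.sum_congr rfl fun x₃ _ => by rw [D.rhsSummand_eq]
    _ ≤ ∑ x, A * (Real.exp (-(D.δ₁ * D.dist0 x)) * c₁) := by
        refine Finset.sum_le_sum fun x _ => ?_
        exact mul_le_mul_of_nonneg_left (mul_le_mul_of_nonneg_left (hsum1 x) (Real.exp_pos _).le) hA
    _ = A * c₁ * ∑ x, Real.exp (-(D.δ₁ * D.dist0 x)) := by
        rw [Finset.mul_sum]
        exact Finset.sum_congr rfl fun x _ => by ring
    _ ≤ A * c₁ * c₀ := mul_le_mul_of_nonneg_left hsum0 (mul_nonneg hA hc₁)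
    _ = _ := by rw [hAdef]; ring

/-- **The second case end to end**: the printed term estimate, the printed display and the lattice sums give, for a
different-blocks term, `‖Σ_{x,x₃} termQ x x₃‖ ≤ (8B₃α₁α₂⁻¹)⁴ E₀ c₀ c₁ e^{−⅓κd_j(X)} (L^jη)⁵` — the per-term input
`hs` of `secondSum_le_of_terms`. [cite: Balaban1987RG1, p.286] -/
theorem differentBlocks_summed_le {P : Type*} [Fintype P] {F : Type*} [NormedAddCommGroup F]
    (D : PointData286 P) (termQ : P → P → F) (hT : TermEstimate286Printed D termQ) (hD : Display286Printed D)
    {c₀ c₁ : ℝ} (hE₀ : 0 ≤ D.E₀) (hL : 0 ≤ D.Ljη) (hc₁ : 0 ≤ c₁)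
    (hsum0 : ∑ x, Real.exp (-(D.δ₁ * D.dist0 x)) ≤ c₀)
    (hsum1 : ∀ x, ∑ x₃, Real.exp (-(D.δ₁ * D.len x x₃)) * D.len x x₃ ≤ c₁) :
    ‖∑ x, ∑ x₃, termQ x x₃‖ ≤
      (8 * D.B₃ * (D.α₁ / D.α₂)) ^ 4 * D.E₀ * c₀ * c₁ * Real.exp (-(1 / 3 * D.κ * D.djX)) * D.Ljη ^ 5 :=
  (hT.trans hD.le).trans (display286_rhs_sum_le D hE₀ hL hc₁ hsum0 hsum1)

/-- **"Summing over x, x₃ we get finally the following estimate"** — the arithmetic of the constant of (4.22).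
Hypotheses by name: the modulus `lhs2` of the second sum of (4.21) is at most the sum, over a finite family `fam` of
partition terms of (4.3) — at most `4⁴` of them (set partitions of the four arguments; Bell(4) ≤ 4⁴,
`B12Ineq45.card_finpartitions_le`) — of per-term bounds `s Q`, each, in BOTH cases of p. 286 and after the x, x₃
summation, at most `(8B₃α₁α₂⁻¹)⁴ E₀ c₀ c₁ e^{−⅓κd_j(X)} (L^jη)⁵` (different blocks: `differentBlocks_summed_le`; same
block: the tree-decay input `SameBlockFactor286Printed` with `sameBlock_product_le`, by name).  Conclusion:
`lhs2 ≤ 4⁴·(8B₃α₁α₂⁻¹)⁴ E₀ c₀ c₁ (…) = (32B₃α₁α₂⁻¹)⁴ E₀ c₀ c₁ e^{−⅓κd_j(X)} (L^jη)⁵` (32 = 2·4²: the (4.5) pattern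
(2n²B₃α₂⁻¹)ⁿ at n = 4). [cite: Balaban1987RG1, (4.22) p.286; (4.5) p.282] -/
theorem secondSum_le_of_terms {T : Type*} (fam : Finset T) (hT : fam.card ≤ 4 ^ 4) (s : T → ℝ)
    {lhs2 B₃ α₁ α₂ E₀ c₀ c₁ κ djX Ljη : ℝ}
    (hK : 0 ≤ (8 * B₃ * (α₁ / α₂)) ^ 4 * E₀ * c₀ * c₁ * Real.exp (-(1 / 3 * κ * djX)) * Ljη ^ 5)
    (hlhs : lhs2 ≤ ∑ Q ∈ fam, s Q)
    (hs : ∀ Q ∈ fam, s Q ≤ (8 * B₃ * (α₁ / α₂)) ^ 4 * E₀ * c₀ * c₁ * Real.exp (-(1 / 3 * κ * djX)) * Ljη ^ 5) :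
    lhs2 ≤ (32 * B₃ * (α₁ / α₂)) ^ 4 * E₀ * c₀ * c₁ * Real.exp (-(1 / 3 * κ * djX)) * Ljη ^ 5 := by
  set K : ℝ := (8 * B₃ * (α₁ / α₂)) ^ 4 * E₀ * c₀ * c₁ * Real.exp (-(1 / 3 * κ * djX)) * Ljη ^ 5 with hKdef
  calc lhs2 ≤ ∑ Q ∈ fam, s Q := hlhs
    _ ≤ ∑ _Q ∈ fam, K := Finset.sum_le_sum hs
    _ = fam.card * K := by rw [Finset.sum_const, nsmul_eq_mul]
    _ ≤ (4 : ℝ) ^ 4 * K := mul_le_mul_of_nonneg_right (by exact_mod_cast hT) hK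
    _ = (32 * B₃ * (α₁ / α₂)) ^ 4 * E₀ * c₀ * c₁ * Real.exp (-(1 / 3 * κ * djX)) * Ljη ^ 5 := by
        rw [hKdef]; ring

/-- **(4.22) from the per-term bounds**, under the sufficient bookkeeping `E₀ ≤ 1 ≤ c₀(δ₁)c₁(δ₁)` (how E₀ and the
partition count enter the printed constant `(32B₃α₁α₂⁻¹c₀(δ₁)c₁(δ₁))⁴` is not displayed; these two inequalities make
`(32B₃α₁α₂⁻¹)⁴E₀c₀c₁ ≤ (32B₃α₁α₂⁻¹c₀c₁)⁴`). [cite: Balaban1987RG1, (4.22) p.286] -/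
theorem kernelBound422_of_terms (D : Data422) {T : Type*} (fam : Finset T) (hT : fam.card ≤ 4 ^ 4) (s : T → ℝ)
    {E₀ : ℝ} (hE₀ : 0 ≤ E₀) (hE₁ : E₀ ≤ 1) (hc : 1 ≤ D.c₀ * D.c₁) (hL : 0 ≤ D.Ljη)
    (hlhs : D.lhs2 ≤ ∑ Q ∈ fam, s Q)
    (hs : ∀ Q ∈ fam, s Q ≤
      (8 * D.B₃ * (D.α₁ / D.α₂)) ^ 4 * E₀ * D.c₀ * D.c₁ * Real.exp (-(1 / 3 * D.κ * D.djX)) * D.Ljη ^ 5) :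
    KernelBound422Printed D := by
  have h8 : 0 ≤ (8 * D.B₃ * (D.α₁ / D.α₂)) ^ 4 := Even.pow_nonneg ⟨2, by norm_num⟩ _
  have h32 : 0 ≤ (32 * D.B₃ * (D.α₁ / D.α₂)) ^ 4 := Even.pow_nonneg ⟨2, by norm_num⟩ _
  have hcc : 0 ≤ D.c₀ * D.c₁ := zero_le_one.trans hc
  have hX : 0 ≤ Real.exp (-(1 / 3 * D.κ * D.djX)) * D.Ljη ^ 5 := mul_nonneg (Real.exp_pos _).le (pow_nonneg hL _)
  have hK : 0 ≤ (8 * D.B₃ * (D.α₁ / D.α₂)) ^ 4 * E₀ * D.c₀ * D.c₁ * Real.exp (-(1 / 3 * D.κ * D.djX)) *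
      D.Ljη ^ 5 := by
    have h := mul_nonneg (mul_nonneg (mul_nonneg h8 hE₀) hcc) hX
    calc (0 : ℝ) ≤ (8 * D.B₃ * (D.α₁ / D.α₂)) ^ 4 * E₀ * (D.c₀ * D.c₁) *
        (Real.exp (-(1 / 3 * D.κ * D.djX)) * D.Ljη ^ 5) := h
      _ = _ := by ring
  have h1 := secondSum_le_of_terms fam hT s hK hlhs hs
  have hE : E₀ * (D.c₀ * D.c₁) ≤ (D.c₀ * D.c₁) ^ 4 :=
    calc E₀ * (D.c₀ * D.c₁) ≤ 1 * (D.c₀ * D.c₁) := mul_le_mul_of_nonneg_right hE₁ hcc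
      _ = (D.c₀ * D.c₁) ^ 1 := by ring
      _ ≤ (D.c₀ * D.c₁) ^ 4 := pow_le_pow_right₀ hc (by norm_num)
  unfold KernelBound422Printed
  refine h1.trans ?_
  calc (32 * D.B₃ * (D.α₁ / D.α₂)) ^ 4 * E₀ * D.c₀ * D.c₁ * Real.exp (-(1 / 3 * D.κ * D.djX)) * D.Ljη ^ 5
      = (32 * D.B₃ * (D.α₁ / D.α₂)) ^ 4 * (E₀ * (D.c₀ * D.c₁)) *
          (Real.exp (-(1 / 3 * D.κ * D.djX)) * D.Ljη ^ 5) := by ring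
    _ ≤ (32 * D.B₃ * (D.α₁ / D.α₂)) ^ 4 * (D.c₀ * D.c₁) ^ 4 *
          (Real.exp (-(1 / 3 * D.κ * D.djX)) * D.Ljη ^ 5) := by
        apply mul_le_mul_of_nonneg_right _ hX
        exact mul_le_mul_of_nonneg_left hE h32
    _ = (32 * D.B₃ * (D.α₁ / D.α₂) * D.c₀ * D.c₁) ^ 4 * Real.exp (-(1 / 3 * D.κ * D.djX)) * D.Ljη ^ 5 := by
        ring

end Literature.MathematicalPhysics.QuantumFieldTheory.Balaban1983to89.B12Sect4Statements

end
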